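import Summits.BirchSwinnertonDyer.BirchSwinnertonDyer.Theorems.RamifiedHeegnerPairLeafPartnerBrandtFixedPoint
import Literature.NumberTheory.Automorphic.BrandtMatrixOne
import HarnessLib

/-!
# Route `RamifiedHeegnerPair`, crux U₁ `LeafRankOneUpperAtThree` (stmt-BirchSwinnertonDyer-26022), line `partnerdescent` —
# input (C4) of the (G3♭ˢ) derivation: (DIV) `w_k ∣ T(n)_{ik}` (`i ≠ k`) for EVERY `n` prime to `N⁺N⁻`, and the exact Eisenstein
# property of the Brandt component group for every such Hecke operator

HONEST FRAMING. Theorems only; helper file (`--supports stmt-BirchSwinnertonDyer-26022 --as helper`); bookkeeping over the tree's Hecke relations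
(`XiSetup.matrix_prime_pow`, `XiSetup.matrix_mul_of_coprime`, `Brandt.matrix_one`) on top of the prime case ‹…LeafPartnerBrandtFixedPoint›; no named
fact, no `sorry`; nothing booked; BSD is proved for no curve. Lead prover bsd-line-rhp-p2 g62, 2026-08-31.

WHAT. The set of integer matrices `M` on `Cls O` with `w_k ∣ M_{ik}` for all `i ≠ k` contains `1`, is closed under sums, integer multiples and
PRODUCTS (`(AB)_{ik} = Σ_{j ≠ k} A_{ij}B_{jk} + A_{ik}B_{kk}`). Since it contains `T(ℓ)` for every prime `ℓ ∤ N⁺N⁻` (fixed-point exclusion,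
`XiSetup.weight_dvd_matrix_of_ne`), the recursion `T(ℓ^{a+2}) = T(ℓ)T(ℓ^{a+1}) − ℓT(ℓ^a)` and `T(mn) = T(m)T(n)` (`(m,n) = 1`) put every `T(n)`,
`gcd(n, N⁺N⁻) = 1`, in it: `XiSetup.weight_dvd_matrix_of_ne_of_coprime`. Consequently ‹…BrandtExactEisenstein›'s `exact_eisenstein_of_weight_dvd` holds
with its hypothesis (DIV) discharged for every such `n`: `(T_n − σ₁(n))·B^∨ ⊆ B` (`exact_eisenstein_of_coprime`).
[cite: Eichler1973, Ch. II §6 Thm. 2 (18)–(19)] [cite: Voight2021, (41.1.1), 41.1.3]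
-/

set_option linter.dupNamespace false
set_option autoImplicit false

noncomputable section

namespace Summit.BirchSwinnertonDyer.BirchSwinnertonDyer.Theorems.LeafPartnerBrandt

open Literature.NumberTheory.Automorphic Literature.NumberTheory.Automorphic.Brandt
open ArithmeticFunction

/-! ## Off-diagonal divisibility is a subring condition -/

section OffDiag

variable {ι : Type*}

/-- Products preserve «`w_k ∣ M_{ik}` for `i ≠ k`». [folklore] -/
theorem forall_dvd_mul_apply_of_ne [Fintype ι] (w : ι → ℤ) {A B : Matrix ι ι ℤ} (hA : ∀ i k, i ≠ k → w k ∣ A i k)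
    (hB : ∀ i k, i ≠ k → w k ∣ B i k) : ∀ i k, i ≠ k → w k ∣ (A * B) i k := by
  intro i k hik
  rw [Matrix.mul_apply]
  refine Finset.dvd_sum fun j _ => ?_
  by_cases hjk : j = k
  · subst hjk
    exact Dvd.dvd.mul_right (hA i j hik) _
  · exact Dvd.dvd.mul_left (hB j k hjk) _

/-- The identity matrix satisfies «`w_k ∣ M_{ik}` for `i ≠ k`». [folklore] -/
theorem forall_dvd_one_apply_of_ne [DecidableEq ι] (w : ι → ℤ) : ∀ i k, i ≠ k → w k ∣ (1 : Matrix ι ι ℤ) i k := by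
  intro i k hik
  rw [Matrix.one_apply_ne hik]
  exact dvd_zero _

/-- Differences `A − c • B` preserve «`w_k ∣ M_{ik}` for `i ≠ k`». [folklore] -/
theorem forall_dvd_sub_smul_apply_of_ne (w : ι → ℤ) {A B : Matrix ι ι ℤ} (c : ℤ)
    (hA : ∀ i k, i ≠ k → w k ∣ A i k) (hB : ∀ i k, i ≠ k → w k ∣ B i k) :
    ∀ i k, i ≠ k → w k ∣ (A - c • B) i k := by
  intro i k hik
  rw [Matrix.sub_apply, Matrix.smul_apply, smul_eq_mul]
  exact dvd_sub (hA i k hik) (Dvd.dvd.mul_left (hB i k hik) _)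

end OffDiag

/-! ## (DIV) for every `n` prime to the level -/

section Coprime

variable {Nplus Nminus : ℕ} (S : XiSetup Nplus Nminus) [Fintype (ClassSet S.O)]

/-- **(DIV) at prime powers**: `w_k ∣ T(ℓ^m)_{ik}` for `i ≠ k`, `ℓ ∤ N⁺N⁻` prime, all `m` (two-step recursion
`T(ℓ^{a+2}) = T(ℓ)T(ℓ^{a+1}) − ℓT(ℓ^a)` from `T(1) = 1` and the prime case). [cite: Eichler1973, Ch. II §6 Thm. 2 (19)] -/
theorem XiSetup.weight_dvd_matrix_prime_pow_of_ne {ℓ : ℕ} (hℓ : ℓ.Prime) (hℓN : ¬ ℓ ∣ Nplus * Nminus) (m : ℕ) :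
    ∀ i k : ClassSet S.O, i ≠ k → (weight S.O k : ℤ) ∣ matrix S.O (ℓ ^ m) i k := by
  classical
  induction m using Nat.twoStepInduction with
  | zero =>
    rw [pow_zero, matrix_one]
    exact forall_dvd_one_apply_of_ne (fun c => (weight S.O c : ℤ))
  | one =>
    rw [pow_one]
    exact fun i k hik => XiSetup.weight_dvd_matrix_of_ne S hℓ hℓN hik
  | more a ha hb =>
    rw [S.matrix_prime_pow hℓ hℓN a]
    exact forall_dvd_sub_smul_apply_of_ne _ (ℓ : ℤ)
      (forall_dvd_mul_apply_of_ne _ (fun i k hik => XiSetup.weight_dvd_matrix_of_ne S hℓ hℓN hik) hb) ha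

/-- **(DIV) `w_k ∣ T(n)_{ik}` for `i ≠ k` and every `n ≥ 1` prime to `N⁺N⁻`, unconditionally** (prime powers by the recursion, coprime
products by `T(mn) = T(m)T(n)`). [cite: Eichler1973, Ch. II §6 Thm. 2 (18)–(19)] [cite: Voight2021, (41.1.1), 41.1.3] -/
theorem XiSetup.weight_dvd_matrix_of_ne_of_coprime {n : ℕ} (hn : n ≠ 0) (hcop : Nat.Coprime n (Nplus * Nminus))
    {i k : ClassSet S.O} (hik : i ≠ k) : (weight S.O k : ℤ) ∣ matrix S.O n i k := by
  classical
  revert hn hcop i k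
  refine Nat.recOnPosPrimePosCoprime (motive := fun n => n ≠ 0 → Nat.Coprime n (Nplus * Nminus) →
    ∀ {i k : ClassSet S.O}, i ≠ k → (weight S.O k : ℤ) ∣ matrix S.O n i k) ?_ ?_ ?_ ?_ n
  · intro p m hp hm _ hcop i k hik
    have hpN : ¬ p ∣ Nplus * Nminus := fun h =>
      hp.ne_one ((Nat.coprime_pow_left_iff hm _ _).mp hcop |>.eq_one_of_dvd h)
    exact XiSetup.weight_dvd_matrix_prime_pow_of_ne S hp hpN m i k hik
  · intro h; exact absurd rfl h
  · intro _ _ i k hik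
    rw [matrix_one]
    exact forall_dvd_one_apply_of_ne (fun c => (weight S.O c : ℤ)) i k hik
  · intro a b ha hb hab iha ihb _ hcop i k hik
    rw [S.matrix_mul_of_coprime hab]
    exact forall_dvd_mul_apply_of_ne _
      (fun i k hik => iha (by omega) (Nat.Coprime.coprime_mul_right hcop) hik)
      (fun i k hik => ihb (by omega) (Nat.Coprime.coprime_mul_left hcop) hik) i k hik

variable [DecidableEq (ClassSet S.O)]

/-- **Exact Eisenstein for every Hecke operator prime to the level**: `(T_n − σ₁(n))·B^∨ ⊆ B` for `B = ℤ[Cls O]⁰`, `gcd(n, N⁺N⁻) = 1`, `n ≥ 1`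
(‹…BrandtExactEisenstein›'s `exact_eisenstein_of_weight_dvd` with (DIV) discharged). [cite: Ribet1990, Prop. 3.1–3.2, Thm. 3.12] [cite: Gross1987, §1–§2] -/
theorem exact_eisenstein_of_coprime {n : ℕ} (hn : n ≠ 0) (hcop : Nat.Coprime n (Nplus * Nminus)) (x : ClassSet S.O → ℚ)
    (hdeg : S.degree x = 0)
    (hdual : ∀ b : ClassSet S.O → ℤ, ∑ c, b c = 0 → ∃ m : ℤ, ∑ c, (weight S.O c : ℚ) * x c * (b c : ℚ) = m) :
    (∀ i, ∃ m : ℤ, (Matrix.toLin' ((matrix S.O n).map (Int.cast : ℤ → ℚ)) x - ((sigma 1 n : ℕ) : ℚ) • x) i = m) ∧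
      S.degree (Matrix.toLin' ((matrix S.O n).map (Int.cast : ℤ → ℚ)) x - ((sigma 1 n : ℕ) : ℚ) • x) = 0 :=
  exact_eisenstein_of_weight_dvd S hn hcop (fun _ _ hik => XiSetup.weight_dvd_matrix_of_ne_of_coprime S hn hcop hik) x hdeg hdual

end Coprime

end Summit.BirchSwinnertonDyer.BirchSwinnertonDyer.Theorems.LeafPartnerBrandt

end
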